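import Literature.Barriers.ValiantsHypothesis.SpanningTreeGadget
import Literature.Computability.Complexity.LindseyLemma
import Literature.Computability.AlgebraicComplexity.OrderedMonomials
import Mathlib.Data.Fintype.CardEmbedding
import HarnessLib

/-!
# The universal distribution for the spanning tree problem (CDGM 2022, §5.2–5.3), I

Chattopadhyay–Datta–Ghosal–Mukhopadhyay (ITCS 2022, arXiv:2109.06941), §5.2: the universal
distribution `Δ` on maps `ν : W ∖ {r} → W` is sampled by embedding the gadget graph `G_{x,y}`
(§5.1, `SpanningTreeGadget.lean`) of uniformly random `x, y ∈ {0,1}^k` along a random injection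
of its vertices and attaching all other vertices to the root; **Lemma 5.2**: "Under the
distribution `Δ`, the discrepancy of `g_P` is `2^{-Ω(n)}` for every nearly-balanced partition
`P`." The proof (§5.3) fixes the embedding `π` and the bits of the sub-gadgets not honoured by
`π` (Def. 5.1); then Alice's view depends only on `x_Good`, Bob's only on `y_Good` (Rem. 5.3),
the sign is `±(-1)^{IP(x_Good,y_Good)}`, and the discrepancy of `IP` (Thm. 2.2, Lindsey) gives
`|D_{u₁,v₁}| ≤ 2^{-|Good_π|/2}` (eqs. (3)–(4)).

This file carries out exactly this per-embedding step, in unnormalised (counting) form.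

* `Sample k N` = (embedding `GV k ↪ Fin N`) × `x` × `y`; `sampleMap ω` the resulting map on
  `Fin N`; `ipInd x y = ±1` (`+1` iff `IP = 1` iff the map is an arborescence,
  `ipInd_eq_of_sampleMap`; `ipSign_eq_ite` links `ip` of `SpanningTreeGadget.lean` with the
  Hadamard sign `ipSign` of `LindseyLemma.lean`).
* `univWeight k N ν = Σ_ω [sampleMap ω = ν]·ipInd` — the signed weight `Z·𝓜` of the universal
  distribution (`Z = #samples`, `sum_abs_univWeight`), nonnegative exactly on arborescences.
* `rectSum_univWeight`: rectangle sums of the weight are signed sample counts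
  `Σ_ω sign(ω)·1_S(view_A ω)·1_T(view_{Aᶜ} ω)` (`aliceView`, `bobView`, `indR`).
* `abs_embSum_le` (**the per-embedding discrepancy**): for a fixed embedding with `g` honoured
  sub-gadgets, `|Σ_{x,y} sign·1_S·1_T| ≤ 4^{k-g}·2^g·√2^g ≤ 4^k (3/4)^g` (split the bits with
  `Equiv.piEquivPiSubtypeProd`, Rem. 5.3 via `aliceView_eq`/`bobView_eq`, the factorisation
  `ipSign_eq_mul_subtype`, and `lindsey` on the honoured bits; `√2/2 ≤ 3/4`).
* `abs_rectSum_univWeight_le`: summing over embeddings,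
  `|Σ_{τ∈S,θ∈T} w(τ ∪ θ)| ≤ 4^k Σ_π (3/4)^{#honoured_A(π)}`.

The averaging over embeddings (CDGM Lemma 5.3, here an exact product computation) and the
resulting bound `disc ≤ γ = 2^{-Ω(N)}` are in `UniversalDistributionCount.lean`.

## References

* [ChattopadhyayDattaGhosalMukhopadhyay2022] §5.2 (sampling process, Lemma 5.2), §5.3
  (Def. 5.1, Rem. 5.3, proof of Lemma 5.2, eqs. (3)–(4)), §4 (the measure `𝓜`), §2 Thm. 2.2.
* [Jukna2012] Appendix A (Lindsey's lemma), via `LindseyLemma.lean`.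
-/

noncomputable section

namespace Literature.Barriers.ValiantsHypothesis

open Literature.Computability.Complexity Literature.Computability.AlgebraicComplexity Finset

variable {k N : ℕ}

/-! ### Signs -/

/-- The sign matrix of `IP` is `(-1)^{IP}`: `ipSign x y = -1` iff `IP_k(x,y) = 1`.
[cite: Jukna2012, proof of Cor. 11.35] -/
theorem ipSign_eq_ite (x y : Fin k → Bool) : ipSign x y = if ip x y = true then -1 else 1 := by
  unfold ipSign ip
  have key : ∀ n ≤ k, (∏ i ∈ Finset.range n,
      (if h : i < k then (if (x ⟨i, h⟩ && y ⟨i, h⟩) = true then (-1 : ℝ) else 1) else 1)) =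
      if ipParity x y n = true then -1 else 1 := by
    intro n hn
    induction n with
    | zero => simp [ipParity]
    | succ n ih =>
      rw [Finset.prod_range_succ, ih (by omega)]
      simp only [ipParity, dif_pos (show n < k by omega)]
      cases ipParity x y n <;> cases (x ⟨n, by omega⟩ && y ⟨n, by omega⟩) <;> norm_num
  rw [← key k le_rfl, ← Fin.prod_univ_eq_prod_range]
  refine Finset.prod_congr rfl fun i _ => ?_
  rw [dif_pos i.isLt]

/-- `±1` according to `IP`: `+1` iff `IP_k(x,y) = 1` iff `G_{x,y}` is a spanning tree (the sign
of the measure `𝓜 = ±Δ` on the sample `(x,y)`). [cite: ChattopadhyayDattaGhosalMukhopadhyay2022, §4 (the measure 𝓜) and §5.3 (Z_P)] -/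
def ipInd (x y : Fin k → Bool) : ℝ := if ip x y = true then 1 else -1

/-- `ipInd = -ipSign`. [folklore] -/
theorem ipInd_eq_neg_ipSign (x y : Fin k → Bool) : ipInd x y = -ipSign x y := by
  rw [ipInd, ipSign_eq_ite]; split_ifs <;> norm_num

/-- The sign matrix factors over a partition of the coordinates:
`(-1)^{⟨x,y⟩} = (-1)^{⟨x_G,y_G⟩} (-1)^{⟨x_B,y_B⟩}`. [cite: ChattopadhyayDattaGhosalMukhopadhyay2022, §5.3 (IP = IP_Bad ⊕ IP_Good)] -/
theorem ipSign_eq_mul_subtype (p : Fin k → Prop) [DecidablePred p] (x y : Fin k → Bool) :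
    ipSign x y = ipSign (fun i : {i // p i} => x i.1) (fun i => y i.1) *
      ipSign (fun i : {i // ¬ p i} => x i.1) (fun i => y i.1) := by
  unfold ipSign
  exact (Fintype.prod_subtype_mul_prod_subtype p _).symm

/-! ### The sample space of the universal distribution -/

/-- Samples of the universal distribution `Δ` (with the uniform measure): an embedding of the
gadget vertices into the `N` non-root vertices and the two bit vectors `x, y`.
[cite: ChattopadhyayDattaGhosalMukhopadhyay2022, §5.2 (sampling process for Δ)] -/
abbrev Sample (k N : ℕ) : Type := (GV k ↪ Fin N) × ((Fin k → Bool) × (Fin k → Bool))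

/-- The map `ν : [N] → [N] ∪ {r}` produced by a sample: the embedded gadget `G_{x,y}`, all
other vertices attached to the root. [cite: ChattopadhyayDattaGhosalMukhopadhyay2022, §5.2] -/
def sampleMap (ω : Sample k N) : Fin N → Option (Fin N) :=
  embedMap ω.1 (gadget ω.2.1 ω.2.2)

open Classical in
/-- The sign of a sample is `+1` iff its map is an arborescence. [cite: ChattopadhyayDattaGhosalMukhopadhyay2022, §5.1, Claim 5.1] -/
theorem ipInd_eq_of_sampleMap (ω : Sample k N) :
    ipInd ω.2.1 ω.2.2 = if IsArborescence (sampleMap ω) then 1 else -1 := by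
  unfold ipInd sampleMap
  rw [isArborescence_embedMap_gadget_iff]
  by_cases h : ip ω.2.1 ω.2.2 = true <;> simp [h]

/-- **The universal signed weight** (`Z · 𝓜`, unnormalised): `w(ν) = Σ_ω [ν_ω = ν] · sign(ω)`,
i.e. `|Δ|`-mass of `ν` times `+1` on arborescences and `-1` elsewhere.
[cite: ChattopadhyayDattaGhosalMukhopadhyay2022, §4 (𝓜) and §5.2 (Δ)] -/
def univWeight (k N : ℕ) (ν : Fin N → Option (Fin N)) : ℝ :=
  ∑ ω : Sample k N, if sampleMap ω = ν then ipInd ω.2.1 ω.2.2 else 0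

open Classical in
/-- The weight is the signed number of samples producing `ν`. [cite: ChattopadhyayDattaGhosalMukhopadhyay2022, §4] -/
theorem univWeight_eq (ν : Fin N → Option (Fin N)) :
    univWeight k N ν = (if IsArborescence ν then 1 else -1) *
      ((univ.filter fun ω : Sample k N => sampleMap ω = ν).card : ℝ) := by
  unfold univWeight
  rw [Finset.card_eq_sum_ones, Nat.cast_sum, Finset.mul_sum, Finset.sum_filter]
  refine sum_congr rfl fun ω _ => ?_
  by_cases h : sampleMap ω = ν
  · rw [if_pos h, if_pos h, ipInd_eq_of_sampleMap, h, Nat.cast_one, mul_one]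
  · rw [if_neg h, if_neg h]

/-- The weight is nonnegative on arborescences. [cite: ChattopadhyayDattaGhosalMukhopadhyay2022, §4] -/
theorem univWeight_nonneg {ν : Fin N → Option (Fin N)} (h : IsArborescence ν) :
    0 ≤ univWeight k N ν := by
  rw [univWeight_eq, if_pos h, one_mul]; exact Nat.cast_nonneg _

/-- The weight is nonpositive off arborescences. [cite: ChattopadhyayDattaGhosalMukhopadhyay2022, §4] -/
theorem univWeight_nonpos {ν : Fin N → Option (Fin N)} (h : ¬ IsArborescence ν) :
    univWeight k N ν ≤ 0 := by
  rw [univWeight_eq, if_neg h]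
  have : (0 : ℝ) ≤ _ := Nat.cast_nonneg ((univ.filter fun ω : Sample k N => sampleMap ω = ν).card)
  linarith

/-- The total mass `Z = Σ_ν |w(ν)|` is the number of samples. [cite: ChattopadhyayDattaGhosalMukhopadhyay2022, §5.2] -/
theorem sum_abs_univWeight : ∑ ν, |univWeight k N ν| = Fintype.card (Sample k N) := by
  classical
  have h : ∀ ν, |univWeight k N ν| = ((univ.filter fun ω : Sample k N => sampleMap ω = ν).card : ℝ) := by
    intro ν
    rw [univWeight_eq, abs_mul]
    split_ifs <;> simp
  simp_rw [h]
  rw [← Nat.cast_sum, ← Finset.card_eq_sum_card_fiberwise (fun ω _ => mem_univ (sampleMap ω))]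
  rfl

/-! ### The players' views and rectangle sums -/

/-- Alice's view of a sample: the map restricted to her vertex set `A`. [cite: ChattopadhyayDattaGhosalMukhopadhyay2022, §5.3 (the maps τ_{(x,y)})] -/
def aliceView (e : GV k ↪ Fin N) (A : Finset (Fin N)) (x y : Fin k → Bool) :
    {i // i ∈ A} → Option (Fin N) := fun i => embedMap e (gadget x y) i.1

/-- Bob's view of a sample: the map restricted to `Aᶜ`. [cite: ChattopadhyayDattaGhosalMukhopadhyay2022, §5.3 (the maps θ_{(x,y)})] -/
def bobView (e : GV k ↪ Fin N) (A : Finset (Fin N)) (x y : Fin k → Bool) :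
    {i // i ∈ Aᶜ} → Option (Fin N) := fun i => embedMap e (gadget x y) i.1

/-- Alice's view does not depend on Bob's honoured bits (Rem. 5.3). [cite: ChattopadhyayDattaGhosalMukhopadhyay2022, §5.3, Rem. 5.3] -/
theorem aliceView_eq (e : GV k ↪ Fin N) (A : Finset (Fin N)) {x y y' : Fin k → Bool}
    (hy : ∀ i, ¬ Honoured e A i → y i = y' i) : aliceView e A x y = aliceView e A x y' :=
  funext fun i => embedMap_gadget_eq_of_mem e A hy i.2

/-- Bob's view does not depend on Alice's honoured bits (Rem. 5.3). [cite: ChattopadhyayDattaGhosalMukhopadhyay2022, §5.3, Rem. 5.3] -/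
theorem bobView_eq (e : GV k ↪ Fin N) (A : Finset (Fin N)) {x x' y : Fin k → Bool}
    (hx : ∀ i, ¬ Honoured e A i → x i = x' i) : bobView e A x y = bobView e A x' y :=
  funext fun i => embedMap_gadget_eq_of_not_mem e A hx (Finset.mem_compl.1 i.2)

/-- Indicator of a finite set, as a real number. [folklore] -/
def indR {α : Type*} [DecidableEq α] (S : Finset α) (a : α) : ℝ := if a ∈ S then 1 else 0

/-- Indicators take values in `[0,1]`. [folklore] -/
theorem abs_indR_le {α : Type*} [DecidableEq α] (S : Finset α) (a : α) : |indR S a| ≤ 1 := by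
  unfold indR; split_ifs <;> simp

/-- **Rectangle sums of the universal weight** are signed sample counts: for Alice's set `A`
and a rectangle `S × T` of views,
`Σ_{τ ∈ S, θ ∈ T} w(τ ∪ θ) = Σ_ω sign(ω) · [view_A(ω) ∈ S] · [view_{Aᶜ}(ω) ∈ T]`.
[cite: ChattopadhyayDattaGhosalMukhopadhyay2022, §4 (proof of Lemma 4.1: 𝓜(α·β) = disc(R)) and §5.3, eq. (3)] -/
theorem rectSum_univWeight (A : Finset (Fin N)) (S : Finset ({i // i ∈ A} → Option (Fin N)))
    (T : Finset ({i // i ∈ Aᶜ} → Option (Fin N))) :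
    ∑ τ ∈ S, ∑ θ ∈ T, univWeight k N ((splitEquiv A).symm (τ, θ)) =
      ∑ ω : Sample k N, ipInd ω.2.1 ω.2.2 *
        indR S (aliceView ω.1 A ω.2.1 ω.2.2) * indR T (bobView ω.1 A ω.2.1 ω.2.2) := by
  classical
  unfold univWeight
  rw [← Finset.sum_product (s := S) (t := T)
    (f := fun p => ∑ ω : Sample k N, if sampleMap ω = (splitEquiv A).symm p then ipInd ω.2.1 ω.2.2 else 0),
    Finset.sum_comm]
  refine sum_congr rfl fun ω _ => ?_
  simp_rw [Equiv.eq_symm_apply]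
  rw [Finset.sum_ite_eq]
  have h1 : (splitEquiv A) (sampleMap ω) ∈ S ×ˢ T ↔
      (aliceView ω.1 A ω.2.1 ω.2.2 ∈ S ∧ bobView ω.1 A ω.2.1 ω.2.2 ∈ T) := by
    rw [Finset.mem_product]; exact Iff.rfl
  by_cases hS : aliceView ω.1 A ω.2.1 ω.2.2 ∈ S <;>
    by_cases hT : bobView ω.1 A ω.2.1 ω.2.2 ∈ T <;> simp [h1, hS, hT, indR]

/-! ### The discrepancy of one embedding (CDGM §5.3) -/

section OneEmbedding

variable (e : GV k ↪ Fin N) (A : Finset (Fin N))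
  (S : Finset ({i // i ∈ A} → Option (Fin N))) (T : Finset ({i // i ∈ Aᶜ} → Option (Fin N)))

/-- The signed rectangle count of one embedding `π`: `4^k · disc_{Δ|π}(Z_P, S_P)` in the
notation of CDGM eq. (3). [cite: ChattopadhyayDattaGhosalMukhopadhyay2022, §5.3, eq. (3)] -/
def embSum : ℝ :=
  ∑ xy : (Fin k → Bool) × (Fin k → Bool),
    ipInd xy.1 xy.2 * indR S (aliceView e A xy.1 xy.2) * indR T (bobView e A xy.1 xy.2)

/-- `2√2 ≤ 3`, numerically. [folklore] -/
theorem two_mul_sqrt_two_le_three : 2 * Real.sqrt 2 ≤ 3 := by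
  have h : Real.sqrt 2 ≤ 3 / 2 := by
    rw [Real.sqrt_le_left (by norm_num)]
    norm_num
  linarith

open Classical in
/-- **Low discrepancy of one embedding** (CDGM §5.3, proof of Lemma 5.2): after fixing the bits
of the dishonoured sub-gadgets, Alice's view depends only on `x_Good` and Bob's only on `y_Good`
(Rem. 5.3) and the sign is `±(-1)^{IP(x_Good, y_Good)}`, so Lindsey's lemma on the honoured bits
gives `|Σ_{x,y} sign · 1_S · 1_T| ≤ 4^{k-g} · 2^g √2^g ≤ 4^k (3/4)^g`, `g` = number of honoured
sub-gadgets ("`|D_{u₁,v₁}| ≤ disc(IP_{|Good_π|}) ≤ 2^{-|Good_π|/2}`").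
[cite: ChattopadhyayDattaGhosalMukhopadhyay2022, §5.3 (proof of Lemma 5.2, eqs. (3)–(4))] -/
theorem abs_embSum_le :
    |embSum e A S T| ≤ 4 ^ k * (3 / 4 : ℝ) ^ (univ.filter fun i => Honoured e A i).card := by
  classical
  set p : Fin k → Prop := fun i => Honoured e A i with hp
  set φ := Equiv.piEquivPiSubtypeProd p (fun _ => Bool) with hφ
  set ψ : (Fin k → Bool) × (Fin k → Bool) ≃
      (({i // p i} → Bool) × ({i // p i} → Bool)) × (({i // ¬ p i} → Bool) × ({i // ¬ p i} → Bool)) :=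
    (φ.prodCongr φ).trans (Equiv.prodProdProdComm _ _ _ _) with hψ
  set F : (Fin k → Bool) × (Fin k → Bool) → ℝ := fun xy =>
    ipInd xy.1 xy.2 * indR S (aliceView e A xy.1 xy.2) * indR T (bobView e A xy.1 xy.2) with hF
  have hsum : embSum e A S T =
      ∑ bb : ({i // ¬ p i} → Bool) × ({i // ¬ p i} → Bool),
        ∑ gg : ({i // p i} → Bool) × ({i // p i} → Bool), F (ψ.symm (gg, bb)) := by
    unfold embSum
    rw [← ψ.symm.sum_comp, Fintype.sum_prod_type, Finset.sum_comm]
  -- restrictions of glued bit vectors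
  have hG : ∀ (uG : {i // p i} → Bool) (uB : {i // ¬ p i} → Bool),
      (fun i : {i // p i} => (φ.symm (uG, uB)) i.1) = uG := by
    intro uG uB; funext i; simp [hφ, i.2]
  have hB : ∀ (uG : {i // p i} → Bool) (uB : {i // ¬ p i} → Bool),
      (fun i : {i // ¬ p i} => (φ.symm (uG, uB)) i.1) = uB := by
    intro uG uB; funext i; simp [hφ, i.2]
  have hinner : ∀ bb : ({i // ¬ p i} → Bool) × ({i // ¬ p i} → Bool),
      |∑ gg : ({i // p i} → Bool) × ({i // p i} → Bool), F (ψ.symm (gg, bb))| ≤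
        2 ^ Fintype.card {i // p i} * Real.sqrt 2 ^ Fintype.card {i // p i} := by
    rintro ⟨xB, yB⟩
    let z : {i // p i} → Bool := fun _ => false
    let a : ({i // p i} → Bool) → ℝ := fun xG =>
      indR S (aliceView e A (φ.symm (xG, xB)) (φ.symm (z, yB)))
    let b : ({i // p i} → Bool) → ℝ := fun yG =>
      indR T (bobView e A (φ.symm (z, xB)) (φ.symm (yG, yB)))
    have hFxy : ∀ xG yG, F (ψ.symm ((xG, yG), (xB, yB))) =
        -(ipSign xB yB) * (a xG * b yG * ipSign xG yG) := by
      intro xG yG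
      have hψ' : ψ.symm ((xG, yG), (xB, yB)) = (φ.symm (xG, xB), φ.symm (yG, yB)) := rfl
      rw [hψ', hF]
      have hA : aliceView e A (φ.symm (xG, xB)) (φ.symm (yG, yB)) =
          aliceView e A (φ.symm (xG, xB)) (φ.symm (z, yB)) :=
        aliceView_eq e A fun i hi => by simp [hφ, show ¬ p i from hi]
      have hBo : bobView e A (φ.symm (xG, xB)) (φ.symm (yG, yB)) =
          bobView e A (φ.symm (z, xB)) (φ.symm (yG, yB)) :=
        bobView_eq e A fun i hi => by simp [hφ, show ¬ p i from hi]
      have hS : ipInd (φ.symm (xG, xB)) (φ.symm (yG, yB)) = -(ipSign xG yG * ipSign xB yB) := by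
        rw [ipInd_eq_neg_ipSign, ipSign_eq_mul_subtype p, hG, hG, hB, hB]
      simp only
      rw [hA, hBo, hS]
      ring
    calc |∑ gg, F (ψ.symm (gg, (xB, yB)))|
        = |∑ xG, ∑ yG, F (ψ.symm ((xG, yG), (xB, yB)))| := by rw [Fintype.sum_prod_type]
      _ = |-(ipSign xB yB) * ∑ xG, ∑ yG, a xG * b yG * ipSign xG yG| := by
          congr 1
          rw [Finset.mul_sum]
          refine sum_congr rfl fun xG _ => ?_
          rw [Finset.mul_sum]
          exact sum_congr rfl fun yG _ => hFxy xG yG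
      _ = |∑ xG, ∑ yG, a xG * b yG * ipSign xG yG| := by
          rw [abs_mul, abs_neg, abs_ipSign, one_mul]
      _ ≤ _ := lindsey a b (fun _ => abs_indR_le _ _) (fun _ => abs_indR_le _ _)
  -- sum over the bits of the dishonoured sub-gadgets
  set g := Fintype.card {i // p i} with hg
  have hgk : Fintype.card {i // ¬ p i} = k - g := by
    rw [Fintype.card_subtype_compl, Fintype.card_fin]
  have hgle : g ≤ k := by
    have := Fintype.card_subtype_le p
    rwa [Fintype.card_fin] at this
  have hcardB : (Fintype.card (({i // ¬ p i} → Bool) × ({i // ¬ p i} → Bool)) : ℝ) = 4 ^ (k - g) := by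
    rw [Fintype.card_prod, Fintype.card_fun, Fintype.card_bool, hgk]
    push_cast
    rw [← mul_pow]
    norm_num
  have hfilter : (univ.filter fun i => Honoured e A i).card = g := by
    rw [hg, Fintype.card_subtype]
  rw [hfilter, hsum]
  calc |∑ bb, ∑ gg, F (ψ.symm (gg, bb))|
      ≤ ∑ bb, |∑ gg, F (ψ.symm (gg, bb))| := abs_sum_le_sum_abs _ _
    _ ≤ ∑ _bb : ({i // ¬ p i} → Bool) × ({i // ¬ p i} → Bool), (2 : ℝ) ^ g * Real.sqrt 2 ^ g :=
        sum_le_sum fun bb _ => hinner bb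
    _ = 4 ^ (k - g) * (2 ^ g * Real.sqrt 2 ^ g) := by
        rw [sum_const, card_univ, nsmul_eq_mul, hcardB]
    _ ≤ 4 ^ (k - g) * (4 ^ g * (3 / 4 : ℝ) ^ g) := by
        apply mul_le_mul_of_nonneg_left _ (by positivity)
        rw [← mul_pow, ← mul_pow]
        apply pow_le_pow_left₀ (by positivity)
        linarith [two_mul_sqrt_two_le_three]
    _ = 4 ^ k * (3 / 4 : ℝ) ^ g := by
        rw [← mul_assoc, ← pow_add, Nat.sub_add_cancel hgle]

end OneEmbedding

open Classical in
/-- **Rectangle sums of the universal weight, bounded by honoured-gadget counts**: for every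
vertex set `A` of Alice and every rectangle `S × T` of views,
`|Σ_{τ∈S, θ∈T} w(τ ∪ θ)| ≤ 4^k · Σ_π (3/4)^{#honoured_A(π)}` (CDGM:
"`disc_Δ(g_P) ≤ Pr[π ∈ F_P] + Σ_{π ∈ H_P} Pr[π] · disc_{Δ|π}(g_P)`", here without splitting
into good and bad embeddings). [cite: ChattopadhyayDattaGhosalMukhopadhyay2022, §5.3 (proof of Lemma 5.2)] -/
theorem abs_rectSum_univWeight_le (A : Finset (Fin N))
    (S : Finset ({i // i ∈ A} → Option (Fin N))) (T : Finset ({i // i ∈ Aᶜ} → Option (Fin N))) :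
    |∑ τ ∈ S, ∑ θ ∈ T, univWeight k N ((splitEquiv A).symm (τ, θ))| ≤
      4 ^ k * ∑ e : GV k ↪ Fin N, (3 / 4 : ℝ) ^ (univ.filter fun i => Honoured e A i).card := by
  rw [rectSum_univWeight, Fintype.sum_prod_type, Finset.mul_sum]
  refine (abs_sum_le_sum_abs _ _).trans (sum_le_sum fun e _ => ?_)
  exact abs_embSum_le e A S T

end Literature.Barriers.ValiantsHypothesis
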